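import Literature.NumberTheory.ConnesConsani2021.EpsSlopeFrobeniusToolkit
import HarnessLib

/-!
# Connes–Consani 2021, Lemma 5.4 numerics: the integrals `∫₀¹u_b` and `∫₀¹u_b²` of the principal
# Frobenius solution against their polynomial truncations (PROVED, no numerics)

RH-FREE corpus literature (label, line 1): elementary truncation bounds for the two integrals a
kernel certificate of `ε′(1⁺) = Σ t(n)` evaluates (`λ(k) = 2∫₀¹u_b/u_b(0)`,
`ψ_k(1)² = 1/(2∫₀¹u_b²)`, `EpsSlopeFrobeniusBridge.lean`); nothing in this file mentions `ζ`,
the critical strip or RH, and nothing here bears on the truth of RH.  bears_on (cell rh-crit,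
corpus C1): apex input (B) — route «ConnesConsaniSemilocal» item K2 `DensitySlope` (stmt 19308),
the (E-b) conjunct of `CC2021_section6_enclosures` (cc R70 tier 2).

Sources: A. Connes, C. Consani, *Weil positivity and trace formula, the archimedean place*, Selecta
Math. (N.S.) 27 (2021) 77 = arXiv:2006.13771 [bib `ConnesConsani2021`], Lemma 5.4 §5 pp. 32–33
(the four printed terms `11.9719 + 8.77574 + 2.20528 + 0.0433983`); [Coddington–Levinson 1955,
Ch. 4 §8] (the Frobenius series).

## What is here (all PROVED, 0 definitions, 0 facts; no `∫`/`Σ'` interchange — sup bound × length)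

* `integral_one_sub_pow` (`∫₀¹(1−x)^k = 1/(k+1)`), `integral_frobPartialSum`
  (`∫₀¹ Σ_{k<K} a_k(1−x)^k = Σ_{k<K} a_k/(k+1)`), `abs_frobPartialSum_le`
  (`|P_K(x)| ≤ Σ_{k<K}|a_k|`);
* **`abs_integral_frobSol_sub_le`**: `|∫₀¹u_b − Σ_{k<K} a_k/(k+1)| ≤ T_K`, `T_K := Σ_k |a_{k+K}|`;
* **`abs_integral_frobSol_sq_sub_le`**:
  `|∫₀¹u_b² − ∫₀¹P_K²| ≤ T_K(2A_K + T_K)`, `A_K := Σ_{k<K}|a_k|`, with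
  `integral_frobPartialSum_sq` (`∫₀¹P_K² = Σ_{i<K}Σ_{j<K} a_ia_j/(i+j+1)`).

WHAT THIS IS NOT: no tail constant, no enclosure; nothing about `ζ` or RH.
-/

noncomputable section

open Real Set Filter Topology MeasureTheory

namespace Literature.NumberTheory.LFunctions

/-- `∫₀¹ (1−x)^k dx = 1/(k+1)`. [folklore] -/
private theorem integral_one_sub_pow (k : ℕ) :
    ∫ x in (0 : ℝ)..1, (1 - x) ^ k = 1 / ((k : ℝ) + 1) := by
  have h := intervalIntegral.integral_comp_sub_left (fun x : ℝ ↦ x ^ k) (1 : ℝ) (a := 0) (b := 1)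
  simp only [sub_zero, sub_self] at h
  rw [h, integral_pow]
  simp

/-- `∫₀¹ P_K = Σ_{k<K} a_k/(k+1)` for the truncation `P_K(x) = Σ_{k<K} a_k(1−x)^k`.
[cite: CoddingtonLevinson1955, Ch. 4 §8] -/
theorem integral_frobPartialSum (b : ℝ) (K : ℕ) :
    ∫ x in (0 : ℝ)..1, ∑ k ∈ Finset.range K, frobCoeff 1 b k * (1 - x) ^ k
      = ∑ k ∈ Finset.range K, frobCoeff 1 b k / ((k : ℝ) + 1) := by
  rw [intervalIntegral.integral_finsetSum fun k _ ↦ ?_]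
  · refine Finset.sum_congr rfl fun k _ ↦ ?_
    rw [intervalIntegral.integral_const_mul, integral_one_sub_pow]
    ring
  · exact (continuous_const.mul ((continuous_const.sub continuous_id).pow k)).intervalIntegrable _ _

/-- `|P_K(x)| ≤ A_K := Σ_{k<K}|a_k|` on `[0,1]`. [cite: CoddingtonLevinson1955, Ch. 4 §8] -/
theorem abs_frobPartialSum_le (b : ℝ) {x : ℝ} (hx : x ∈ Icc (0 : ℝ) 1) (K : ℕ) :
    |∑ k ∈ Finset.range K, frobCoeff 1 b k * (1 - x) ^ k|
      ≤ ∑ k ∈ Finset.range K, |frobCoeff 1 b k| := by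
  refine (Finset.abs_sum_le_sum_abs _ _).trans (Finset.sum_le_sum fun k _ ↦ ?_)
  have ht0 : 0 ≤ 1 - x := by linarith [hx.2]
  have ht1 : 1 - x ≤ 1 := by linarith [hx.1]
  rw [abs_mul, abs_pow, abs_of_nonneg ht0]
  exact mul_le_of_le_one_right (abs_nonneg _) (pow_le_one₀ ht0 ht1)

/-- **`|∫₀¹u_b − Σ_{k<K} a_k/(k+1)| ≤ T_K = Σ_k|a_{k+K}|`** (sup bound on `[0,1]` × length `1`).
[cite: ConnesConsani2021, Lemma 5.4 §5 pp. 32–33; CoddingtonLevinson1955, Ch. 4 §8] -/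
theorem abs_integral_frobSol_sub_le (b : ℝ) (K : ℕ) :
    |(∫ x in (0 : ℝ)..1, frobSol 1 b x) - ∑ k ∈ Finset.range K, frobCoeff 1 b k / ((k : ℝ) + 1)|
      ≤ ∑' k, |frobCoeff 1 b (k + K)| := by
  have hu : IntervalIntegrable (frobSol 1 b) volume (0 : ℝ) 1 :=
    (continuousOn_frobSol_Icc one_pos b).intervalIntegrable_of_Icc zero_le_one
  have hP : IntervalIntegrable (fun x ↦ ∑ k ∈ Finset.range K, frobCoeff 1 b k * (1 - x) ^ k)
      volume (0 : ℝ) 1 :=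
    (continuous_finsetSum _ fun k _ ↦
      continuous_const.mul ((continuous_const.sub continuous_id).pow k)).intervalIntegrable _ _
  rw [← integral_frobPartialSum, ← intervalIntegral.integral_sub hu hP]
  have h := intervalIntegral.norm_integral_le_of_norm_le_const (a := (0 : ℝ)) (b := 1)
    (C := ∑' k, |frobCoeff 1 b (k + K)|)
    (f := fun x ↦ frobSol 1 b x - ∑ k ∈ Finset.range K, frobCoeff 1 b k * (1 - x) ^ k) ?_
  · simpa using h
  · intro x hx
    rw [uIoc_of_le zero_le_one] at hx
    rw [Real.norm_eq_abs]
    exact abs_frobSol_sub_sum_le b ⟨hx.1.le, hx.2⟩ K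

/-- `∫₀¹ P_K² = Σ_{i<K}Σ_{j<K} a_ia_j/(i+j+1)`. [cite: CoddingtonLevinson1955, Ch. 4 §8] -/
theorem integral_frobPartialSum_sq (b : ℝ) (K : ℕ) :
    ∫ x in (0 : ℝ)..1, (∑ k ∈ Finset.range K, frobCoeff 1 b k * (1 - x) ^ k) ^ 2
      = ∑ i ∈ Finset.range K, ∑ j ∈ Finset.range K,
          frobCoeff 1 b i * frobCoeff 1 b j / ((i : ℝ) + j + 1) := by
  have e : ∀ x : ℝ, (∑ k ∈ Finset.range K, frobCoeff 1 b k * (1 - x) ^ k) ^ 2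
      = ∑ i ∈ Finset.range K, ∑ j ∈ Finset.range K,
          frobCoeff 1 b i * frobCoeff 1 b j * (1 - x) ^ (i + j) := by
    intro x
    rw [sq, Finset.sum_mul_sum]
    refine Finset.sum_congr rfl fun i _ ↦ Finset.sum_congr rfl fun j _ ↦ ?_
    rw [pow_add]; ring
  simp_rw [e]
  have hint : ∀ i j : ℕ, IntervalIntegrable
      (fun x : ℝ ↦ frobCoeff 1 b i * frobCoeff 1 b j * (1 - x) ^ (i + j)) volume (0 : ℝ) 1 :=
    fun i j ↦
      (continuous_const.mul ((continuous_const.sub continuous_id).pow _)).intervalIntegrable _ _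
  have hint2 : ∀ i : ℕ, IntervalIntegrable (fun x : ℝ ↦ ∑ j ∈ Finset.range K,
      frobCoeff 1 b i * frobCoeff 1 b j * (1 - x) ^ (i + j)) volume (0 : ℝ) 1 :=
    fun i ↦ (continuous_finsetSum _ fun j _ ↦ (continuous_const.mul
      ((continuous_const.sub continuous_id).pow _) :
        Continuous fun x : ℝ ↦
          frobCoeff 1 b i * frobCoeff 1 b j * (1 - x) ^ (i + j))).intervalIntegrable _ _
  rw [intervalIntegral.integral_finsetSum fun i _ ↦ hint2 i]
  refine Finset.sum_congr rfl fun i _ ↦ ?_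
  rw [intervalIntegral.integral_finsetSum fun j _ ↦ hint i j]
  refine Finset.sum_congr rfl fun j _ ↦ ?_
  rw [intervalIntegral.integral_const_mul, integral_one_sub_pow]
  push_cast
  ring

/-- **`|∫₀¹u_b² − ∫₀¹P_K²| ≤ T_K(2A_K + T_K)`** (`u² − P² = (u−P)(u+P)`, `|u−P| ≤ T_K`,
`|u+P| ≤ 2A_K + T_K` on `[0,1]`).
[cite: ConnesConsani2021, Lemma 5.4 §5 pp. 32–33; CoddingtonLevinson1955, Ch. 4 §8] -/
theorem abs_integral_frobSol_sq_sub_le (b : ℝ) (K : ℕ) :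
    |(∫ x in (0 : ℝ)..1, frobSol 1 b x ^ 2)
        - ∫ x in (0 : ℝ)..1, (∑ k ∈ Finset.range K, frobCoeff 1 b k * (1 - x) ^ k) ^ 2|
      ≤ (∑' k, |frobCoeff 1 b (k + K)|)
          * (2 * ∑ k ∈ Finset.range K, |frobCoeff 1 b k| + ∑' k, |frobCoeff 1 b (k + K)|) := by
  set T : ℝ := ∑' k, |frobCoeff 1 b (k + K)| with hT
  set A : ℝ := ∑ k ∈ Finset.range K, |frobCoeff 1 b k| with hA
  have hT0 : 0 ≤ T := tsum_nonneg fun k ↦ abs_nonneg _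
  have hPc : Continuous (fun x : ℝ ↦ ∑ k ∈ Finset.range K, frobCoeff 1 b k * (1 - x) ^ k) :=
    continuous_finsetSum _ fun k _ ↦
      continuous_const.mul ((continuous_const.sub continuous_id).pow k)
  have hu : IntervalIntegrable (fun x ↦ frobSol 1 b x ^ 2) volume (0 : ℝ) 1 :=
    ((continuousOn_frobSol_Icc one_pos b).pow 2).intervalIntegrable_of_Icc zero_le_one
  have hP : IntervalIntegrable
      (fun x ↦ (∑ k ∈ Finset.range K, frobCoeff 1 b k * (1 - x) ^ k) ^ 2) volume (0 : ℝ) 1 :=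
    (hPc.pow 2).intervalIntegrable _ _
  rw [← intervalIntegral.integral_sub hu hP]
  have h := intervalIntegral.norm_integral_le_of_norm_le_const (a := (0 : ℝ)) (b := 1)
    (C := T * (2 * A + T))
    (f := fun x ↦ frobSol 1 b x ^ 2 - (∑ k ∈ Finset.range K, frobCoeff 1 b k * (1 - x) ^ k) ^ 2) ?_
  · simpa using h
  · intro x hx
    rw [uIoc_of_le zero_le_one] at hx
    have hx' : x ∈ Icc (0 : ℝ) 1 := ⟨hx.1.le, hx.2⟩
    have hd := abs_frobSol_sub_sum_le b hx' K
    have hp := abs_frobPartialSum_le b hx' K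
    rw [← hT] at hd; rw [← hA] at hp
    set u := frobSol 1 b x
    set P := ∑ k ∈ Finset.range K, frobCoeff 1 b k * (1 - x) ^ k
    rw [Real.norm_eq_abs, sq_sub_sq, abs_mul]
    have h1 : |u + P| ≤ 2 * A + T := by
      calc |u + P| = |(u - P) + 2 * P| := by ring_nf
        _ ≤ |u - P| + |2 * P| := abs_add_le _ _
        _ ≤ T + 2 * A := by rw [abs_mul, abs_two]; linarith
        _ = 2 * A + T := by ring
    calc |u + P| * |u - P| ≤ (2 * A + T) * T :=
          mul_le_mul h1 hd (abs_nonneg _) (by positivity)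
      _ = T * (2 * A + T) := by ring

end Literature.NumberTheory.LFunctions

end
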